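import Literature.NumberTheory.GelbartRogawski1991.UnitaryDualPairThetaKernelCMTwistDetArch
import Literature.NumberTheory.Automorphic.UnitaryGroupArchSection
import Literature.NumberTheory.Automorphic.UnitaryLineArchTypes
import HarnessLib

/-!
# The normalising twist `s ⊗ (χ_V ∘ det)` SHIFTS the vacuum exponent at each archimedean place by the
# archimedean type of `χ_V` (Gelbart–Rogawski 1991 §3.1 Remark, p. 457)

Topic `NumberTheory/GelbartRogawski1991`; namespace `Literature.NumberTheory.GelbartRogawski1991.UnitaryDualPair`
(§1 lives in `Literature.NumberTheory.Automorphic.UnitaryGroup`).  Continues `UnitaryDualPairThetaKernelCMTwist`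
(the normalised pair splitting `cmPairSplittingTwist hGR η = s_pair ⊗ η` of the CM dual pair
`U(diag dV) × U(diag dW)` over `L/L⁺`, `cmPairRepTwist = η • (ω_ψ ∘ s_pair)`) and `…CMTwistDetArch` (the value of the
character of record `η = (χ_V ∘ det_V) ⊠ (χ_W ∘ det_W)` on archimedean components: `η ((x, 1), 1) = χ_V (cl (det_∞ x))`).

[GelbartRogawski1991, §3.1 Remark p. 457 L4–13]: a compatible splitting is determined only up to `s ↦ s ⊗ ν′`,
`ν′` an automorphic character of `E¹` through `det`; hence NO local component of a compatible splitting is pinned by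
Prop. 3.1.1, and a consumer that needs a prescribed archimedean behaviour (e.g. «the Gaussian at a definite place `w`
is FIXED by `U(V_w)`») obtains it by NORMALISING: twisting by `χ_V ∘ det_V` with `χ_V` of a suitable archimedean
type.  This file supplies the bookkeeping of that normalisation AT ONE ARCHIMEDEAN PLACE:

* §1 (`Automorphic.UnitaryGroup`, any CM hermitian `H` with `det H ≠ 0`): the archimedean determinant
  `det_∞ = cmArchDet : U(H)(L ⊗ ℝ) → U(1)(L⁺ ⊗ ℝ)` read through the place characters —
  `coe_archPlaceChar_cmArchDet : ι_w (det_∞ k)_w = det (k_w)` (`k_w = archAt w k ∈ U(σ_w H)(ℂ)`), hence on the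
  one-place section `archSingle w₀` (`u` at `w₀`, `1` elsewhere): `ι_{w₀}(det_∞ (archSingle w₀ u)) = det u`,
  `ι_w(…) = 1` for `w ≠ w₀`, and **`archWeight_cmArchDet_archSingle : archWeight L m (det_∞ (archSingle w₀ u)) = (det u)^{m w₀}`**;
* §2 (the CM pair, `η := cmDetTwistChar (charOfUnitaryLineChar χ_V) (charOfUnitaryLineChar χ_W)`, `χ_V` of archimedean
  type `nV`, `HasArchType`): on the one-place element `x_u := ((archSingle w₀ u, 1_f), 1) ∈ U(V)(𝔸) × U(W)(𝔸)`,
  **`η x_u = (det u)^{nV w₀}`** (`coe_cmDetTwistChar_archSingle_one`), so the normalised Weil action is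
  `(det u)^{nV w₀} •` the raw one (`cmPairRepTwist_archSingle_one_apply`); consequently THE VACUUM SHIFT
  **`cmPairRepTwist_archSingle_one_eq_zpow_smul`**: if `U(σ_{w₀} V)(ℂ)` acts on a vector `Φ` through the raw splitting
  by `(det u)^a` (the shape delivered at a definite place by `KonnoKonno2007/JunctionVacuumDefinite`), then through the
  normalised splitting it acts by `(det u)^{a + nV w₀}` — and FIXES `Φ` when `nV w₀ = −a`
  (`cmPairRepTwist_archSingle_one_eq_self`); the same through a frame `ᵗḡ H g = diag dV` for the hermitian matrix `H`
  of record (`coe_cmDetTwistChar_cmKTypeHom_archSingle_one`);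
* §3 the normalising character EXISTS for every prescription: `exists_unitaryLineChar_hasArchType` of the tree gives
  `χ_V` of type `t − a` for any raw exponents `a` and targets `t : InfinitePlace L → ℤ`
  (`exists_hasArchType_sub`), whence `exists_twist_forall_archSingle_eq_zpow_smul`: a normalisation realising ALL
  target exponents `t w₀` at once, place by place.

Use (Hodge-CM model-construction cell, BINDER-TRIAGE §61–§62, ruling (S-norm)): the RUN-37 `S`-term normalises the
second small splitting `s₂` and the big splitting at the definite places (`t w = 0` for `w ≠ w(ι₁)`), making the
definite-place identity (c5) true by construction; this file is the generic half of that step.  KERNEL ONLY: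
0 records, 0 new definitions, 0 sorry; every cited tag is provenance on a proved statement.

References: S. Gelbart, J. Rogawski, Invent. Math. 105 (1991) §3.1 Remark p. 457 [GelbartRogawski1991];
A. Borel, H. Jacquet, PSPM 33.1 (1979) §4.1 (`G_∞ = ∏_v G(F_v)`) [BorelJacquet1979].
-/

set_option autoImplicit false

noncomputable section

open scoped Matrix
open NumberField NumberField.InfinitePlace

/-! ## §1. `det_∞` through the place characters; the one-place section -/

namespace Literature.NumberTheory.Automorphic

namespace UnitaryGroup

section PlaceDet

variable (L : Type) [Field L] [NumberField L] [IsCMField L] (N : ℕ) (H : Matrix (Fin N) (Fin N) L) (hH : H.det ≠ 0)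

/-- **`ι_w ((det_∞ k)_w) = det (k_w)`**: the `w`-th place character of the archimedean determinant of
`k ∈ U(H)(L ⊗ ℝ)` is the determinant of its `w`-component `archAt w k ∈ U(σ_w H)(ℂ)`. [cite: BorelJacquet1979, §4.1] -/
theorem coe_archPlaceChar_cmArchDet
    (k : arch (↥(maximalRealSubfield L)) L (IsCMField.complexConj L) N H) (w : {w : InfinitePlace L // IsComplex w}) :
    ((archPlaceChar L w.1 (cmArchDet L N H hH k) : Circle) : ℂ) =
      (((archAt (↥(maximalRealSubfield L)) L (IsCMField.complexConj L) N H w (complexConj_smul_infinitePlace L w.1)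
          (IsCMField.complexConj_ne_one L) k : archLocal L N H w) : GL (Fin N) ℂ) : Matrix (Fin N) (Fin N) ℂ).det := by
  rw [coe_archPlaceChar, coe_coe_cmArchDet]
  set D : mixedEmbedding.mixedSpace L :=
    ((k : GL (Fin N) (mixedEmbedding.mixedSpace L)) : Matrix (Fin N) (Fin N) (mixedEmbedding.mixedSpace L)).det with hD
  have h1 : Completion.extensionEmbedding w.1 (((InfiniteAdeleRing.ringEquiv_mixedSpace L).symm D) w.1) =
      ((InfiniteAdeleRing.ringEquiv_mixedSpace L) ((InfiniteAdeleRing.ringEquiv_mixedSpace L).symm D)).2 w := rfl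
  rw [h1, RingEquiv.apply_symm_apply, hD, ← evalC_apply, RingHom.map_det]
  rfl

/-- The same indexed by a place of `L` (every infinite place of the CM field `L` is complex). [cite: BorelJacquet1979, §4.1] -/
theorem coe_archPlaceChar_cmArchDet' (k : arch (↥(maximalRealSubfield L)) L (IsCMField.complexConj L) N H)
    (w : InfinitePlace L) :
    ((archPlaceChar L w (cmArchDet L N H hH k) : Circle) : ℂ) =
      (((archAt (↥(maximalRealSubfield L)) L (IsCMField.complexConj L) N H ⟨w, IsTotallyComplex.isComplex w⟩
          (complexConj_smul_infinitePlace L w) (IsCMField.complexConj_ne_one L) k :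
            archLocal L N H ⟨w, IsTotallyComplex.isComplex w⟩) : GL (Fin N) ℂ) : Matrix (Fin N) (Fin N) ℂ).det :=
  coe_archPlaceChar_cmArchDet L N H hH k ⟨w, IsTotallyComplex.isComplex w⟩

variable (w₀ : {w : InfinitePlace L // IsComplex w})

/-- **`ι_{w₀}(det_∞ (u at w₀, 1 elsewhere)) = det u`.** [cite: BorelJacquet1979, §4.1] -/
theorem coe_archPlaceChar_cmArchDet_archSingle_self (u : archLocal L N H w₀) :
    ((archPlaceChar L w₀.1 (cmArchDet L N H hH
        (archSingle (↥(maximalRealSubfield L)) L (IsCMField.complexConj L) N H (IsCMField.complexConj_ne_one L)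
          (complexConj_smul_infinitePlace L) w₀ u)) : Circle) : ℂ) =
      (((u : archLocal L N H w₀) : GL (Fin N) ℂ) : Matrix (Fin N) (Fin N) ℂ).det := by
  rw [coe_archPlaceChar_cmArchDet, archAt_archSingle_self]

/-- **`ι_w(det_∞ (u at w₀, 1 elsewhere)) = 1` for `w ≠ w₀`.** [cite: BorelJacquet1979, §4.1] -/
theorem coe_archPlaceChar_cmArchDet_archSingle_of_ne (u : archLocal L N H w₀) {w : InfinitePlace L} (hw : w ≠ w₀.1) :
    ((archPlaceChar L w (cmArchDet L N H hH
        (archSingle (↥(maximalRealSubfield L)) L (IsCMField.complexConj L) N H (IsCMField.complexConj_ne_one L)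
          (complexConj_smul_infinitePlace L) w₀ u)) : Circle) : ℂ) = 1 := by
  have hne : (⟨w, IsTotallyComplex.isComplex w⟩ : {w : InfinitePlace L // IsComplex w}) ≠ w₀ :=
    fun h => hw (congrArg Subtype.val h)
  rw [coe_archPlaceChar_cmArchDet', archAt_archSingle_of_ne _ _ _ _ _ _ _ _ hne, OneMemClass.coe_one, Units.val_one,
    Matrix.det_one]

/-- **The typed weight of a one-place element**: `archWeight L m (det_∞ (u at w₀, 1 elsewhere)) = (det u)^{m w₀}`.
[cite: BorelJacquet1979, §4.1] -/
theorem archWeight_cmArchDet_archSingle (m : InfinitePlace L → ℤ) (u : archLocal L N H w₀) :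
    archWeight L m (cmArchDet L N H hH
        (archSingle (↥(maximalRealSubfield L)) L (IsCMField.complexConj L) N H (IsCMField.complexConj_ne_one L)
          (complexConj_smul_infinitePlace L) w₀ u)) =
      (((u : archLocal L N H w₀) : GL (Fin N) ℂ) : Matrix (Fin N) (Fin N) ℂ).det ^ (m w₀.1) := by
  rw [archWeight_eq_prod, Finset.prod_eq_single w₀.1]
  · rw [coe_archPlaceChar_cmArchDet_archSingle_self]
  · intro w _ hw
    rw [coe_archPlaceChar_cmArchDet_archSingle_of_ne L N H hH w₀ u hw, one_zpow]
  · intro h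
    exact absurd (Finset.mem_univ _) h

omit [NumberField L] [IsCMField L] in
/-- `det u ≠ 0` for `u ∈ U(σ_w H)(ℂ) ≤ GL_N(ℂ)`. [folklore] -/
theorem det_coe_archLocal_ne_zero (u : archLocal L N H w₀) :
    (((u : archLocal L N H w₀) : GL (Fin N) ℂ) : Matrix (Fin N) (Fin N) ℂ).det ≠ 0 := by
  rw [← Matrix.GeneralLinearGroup.val_det_apply]
  exact Units.ne_zero _

end PlaceDet

end UnitaryGroup

end Literature.NumberTheory.Automorphic

/-! ## §2. The normalising character and the vacuum shift at one place -/

namespace Literature.NumberTheory.GelbartRogawski1991.UnitaryDualPair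

open Literature.NumberTheory.Automorphic Literature.NumberTheory.Automorphic.UnitaryGroup
open Literature.NumberTheory.Weil1964

section OnePlace

variable (L : Type) [Field L] [NumberField L] [IsCMField L] {N M n : ℕ} (e : Fin N × Fin M ≃ Fin n)
variable (dV : Fin N → L) (hdV : ∀ i, IsCMField.complexConj L (dV i) = dV i) (hdV0 : ∀ i, dV i ≠ 0)
variable (dW : Fin M → L) (hdW : ∀ i, IsCMField.complexConj L (dW i) = dW i) (hdW0 : ∀ i, dW i ≠ 0)
variable (hGR : (cmSplittingDatum L e dV hdV hdV0 dW hdW hdW0).CompatibleSplitting)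
variable (χV χW : ContinuousMonoidHom
  (relNormOneIdeles (↥(maximalRealSubfield L)) L ⧸ relNormOneRat (↥(maximalRealSubfield L)) L) Circle)
variable {nV : InfinitePlace L → ℤ}
variable (w₀ : {w : InfinitePlace L // IsComplex w})

/-- **`η` on a one-place element**: for `u ∈ U(σ_{w₀}(diag dV))(ℂ)` and `χ_V` of archimedean type `nV`,
`η ((u at w₀, 1 elsewhere; 1_f), 1) = (det u)^{nV w₀}`. [cite: GelbartRogawski1991, §3.1 Remark p. 457 L9–13] -/
theorem coe_cmDetTwistChar_archSingle_one (hnV : UnitaryLineChar.HasArchType L χV nV)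
    (u : archLocal L N (Matrix.diagonal dV) w₀) :
    ((cmDetTwistChar L dV hdV0 dW hdW0 (charOfUnitaryLineChar L χV) (charOfUnitaryLineChar L χW)
        (archToAdelic (↥(maximalRealSubfield L)) L (IsCMField.complexConj L) N (Matrix.diagonal dV)
          (archSingle (↥(maximalRealSubfield L)) L (IsCMField.complexConj L) N (Matrix.diagonal dV)
            (IsCMField.complexConj_ne_one L) (complexConj_smul_infinitePlace L) w₀ u), 1) : ℂˣ) : ℂ) =
      (((u : archLocal L N (Matrix.diagonal dV) w₀) : GL (Fin N) ℂ) : Matrix (Fin N) (Fin N) ℂ).det ^ (nV w₀.1) := by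
  rw [cmDetTwistChar_archToAdelic_one, Circle.toUnits_apply, Units.val_mk0,
    (UnitaryLineChar.hasArchType_iff L χV nV).1 hnV, archWeight_cmArchDet_archSingle]

/-- The same through a frame `ᵗḡ H g = diag dV` of the hermitian matrix `H` of record: for `u ∈ U(σ_{w₀} H)(ℂ)`,
`η (g_𝔸⁻¹ ((u at w₀, 1 elsewhere), 1_f) g_𝔸, 1) = (det u)^{nV w₀}`. [cite: GelbartRogawski1991, §3.1 Remark p. 457 L9–13] -/
theorem coe_cmDetTwistChar_cmKTypeHom_archSingle_one (hnV : UnitaryLineChar.HasArchType L χV nV)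
    (H : Matrix (Fin N) (Fin N) L) (g : GL (Fin N) L)
    (hg : ((g : Matrix (Fin N) (Fin N) L).map (cmConjRingHom L))ᵀ * H * (g : Matrix (Fin N) (Fin N) L) =
      Matrix.diagonal dV)
    (u : archLocal L N H w₀) :
    ((cmDetTwistChar L dV hdV0 dW hdW0 (charOfUnitaryLineChar L χV) (charOfUnitaryLineChar L χW)
        (cmKTypeHom L H g dV hg
          (archToAdelic (↥(maximalRealSubfield L)) L (IsCMField.complexConj L) N H
            (archSingle (↥(maximalRealSubfield L)) L (IsCMField.complexConj L) N H
              (IsCMField.complexConj_ne_one L) (complexConj_smul_infinitePlace L) w₀ u)), 1) : ℂˣ) : ℂ) =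
      (((u : archLocal L N H w₀) : GL (Fin N) ℂ) : Matrix (Fin N) (Fin N) ℂ).det ^ (nV w₀.1) := by
  rw [cmDetTwistChar_cmKTypeHom_archToAdelic, Circle.toUnits_apply, Units.val_mk0,
    (UnitaryLineChar.hasArchType_iff L χV nV).1 hnV, archWeight_cmArchDet_archSingle]

/-- **The normalised Weil action on a one-place element is `(det u)^{nV w₀} •` the raw one.**
[cite: GelbartRogawski1991, §3.1 Remark p. 457 L4–13] -/
theorem cmPairRepTwist_archSingle_one_apply (hnV : UnitaryLineChar.HasArchType L χV nV)
    (u : archLocal L N (Matrix.diagonal dV) w₀) (Φ : CMSchwartz L n) :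
    cmPairRepTwist L e dV hdV hdV0 dW hdW hdW0 hGR
        (cmDetTwistChar L dV hdV0 dW hdW0 (charOfUnitaryLineChar L χV) (charOfUnitaryLineChar L χW))
        (archToAdelic (↥(maximalRealSubfield L)) L (IsCMField.complexConj L) N (Matrix.diagonal dV)
          (archSingle (↥(maximalRealSubfield L)) L (IsCMField.complexConj L) N (Matrix.diagonal dV)
            (IsCMField.complexConj_ne_one L) (complexConj_smul_infinitePlace L) w₀ u), 1) Φ =
      (((u : archLocal L N (Matrix.diagonal dV) w₀) : GL (Fin N) ℂ) : Matrix (Fin N) (Fin N) ℂ).det ^ (nV w₀.1) •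
        cmPairRep L e dV hdV hdV0 dW hdW hdW0 hGR
          (archToAdelic (↥(maximalRealSubfield L)) L (IsCMField.complexConj L) N (Matrix.diagonal dV)
            (archSingle (↥(maximalRealSubfield L)) L (IsCMField.complexConj L) N (Matrix.diagonal dV)
              (IsCMField.complexConj_ne_one L) (complexConj_smul_infinitePlace L) w₀ u), 1) Φ := by
  rw [cmPairRepTwist_apply_eq_smul, coe_cmDetTwistChar_archSingle_one L dV hdV0 dW hdW0 χV χW w₀ hnV]

/-- **THE VACUUM SHIFT AT ONE PLACE.**  If `U(σ_{w₀} V)(ℂ)` acts on `Φ` through the raw splitting by `(det u)^a`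
(the shape `KonnoKonno2007/JunctionVacuumDefinite` delivers for the Gaussian at a definite place), then through the
normalised splitting it acts by `(det u)^{a + nV w₀}`. [cite: GelbartRogawski1991, §3.1 Remark p. 457 L4–13] -/
theorem cmPairRepTwist_archSingle_one_eq_zpow_smul (hnV : UnitaryLineChar.HasArchType L χV nV)
    {Φ : CMSchwartz L n} {a : ℤ}
    (hΦ : ∀ u : archLocal L N (Matrix.diagonal dV) w₀,
      cmPairRep L e dV hdV hdV0 dW hdW hdW0 hGR
          (archToAdelic (↥(maximalRealSubfield L)) L (IsCMField.complexConj L) N (Matrix.diagonal dV)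
            (archSingle (↥(maximalRealSubfield L)) L (IsCMField.complexConj L) N (Matrix.diagonal dV)
              (IsCMField.complexConj_ne_one L) (complexConj_smul_infinitePlace L) w₀ u), 1) Φ =
        (((u : archLocal L N (Matrix.diagonal dV) w₀) : GL (Fin N) ℂ) : Matrix (Fin N) (Fin N) ℂ).det ^ a • Φ)
    (u : archLocal L N (Matrix.diagonal dV) w₀) :
    cmPairRepTwist L e dV hdV hdV0 dW hdW hdW0 hGR
        (cmDetTwistChar L dV hdV0 dW hdW0 (charOfUnitaryLineChar L χV) (charOfUnitaryLineChar L χW))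
        (archToAdelic (↥(maximalRealSubfield L)) L (IsCMField.complexConj L) N (Matrix.diagonal dV)
          (archSingle (↥(maximalRealSubfield L)) L (IsCMField.complexConj L) N (Matrix.diagonal dV)
            (IsCMField.complexConj_ne_one L) (complexConj_smul_infinitePlace L) w₀ u), 1) Φ =
      (((u : archLocal L N (Matrix.diagonal dV) w₀) : GL (Fin N) ℂ) : Matrix (Fin N) (Fin N) ℂ).det ^ (a + nV w₀.1) • Φ := by
  rw [cmPairRepTwist_archSingle_one_apply L e dV hdV hdV0 dW hdW hdW0 hGR χV χW w₀ hnV, hΦ u, smul_smul,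
    ← zpow_add₀ (det_coe_archLocal_ne_zero L N (Matrix.diagonal dV) w₀ u), add_comm]

/-- **… and FIXES `Φ` when the type is chosen opposite to the raw exponent: `nV w₀ = −a`.**
[cite: GelbartRogawski1991, §3.1 Remark p. 457 L4–13] -/
theorem cmPairRepTwist_archSingle_one_eq_self (hnV : UnitaryLineChar.HasArchType L χV nV)
    {Φ : CMSchwartz L n} {a : ℤ}
    (hΦ : ∀ u : archLocal L N (Matrix.diagonal dV) w₀,
      cmPairRep L e dV hdV hdV0 dW hdW hdW0 hGR
          (archToAdelic (↥(maximalRealSubfield L)) L (IsCMField.complexConj L) N (Matrix.diagonal dV)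
            (archSingle (↥(maximalRealSubfield L)) L (IsCMField.complexConj L) N (Matrix.diagonal dV)
              (IsCMField.complexConj_ne_one L) (complexConj_smul_infinitePlace L) w₀ u), 1) Φ =
        (((u : archLocal L N (Matrix.diagonal dV) w₀) : GL (Fin N) ℂ) : Matrix (Fin N) (Fin N) ℂ).det ^ a • Φ)
    (hn : nV w₀.1 = -a) (u : archLocal L N (Matrix.diagonal dV) w₀) :
    cmPairRepTwist L e dV hdV hdV0 dW hdW hdW0 hGR
        (cmDetTwistChar L dV hdV0 dW hdW0 (charOfUnitaryLineChar L χV) (charOfUnitaryLineChar L χW))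
        (archToAdelic (↥(maximalRealSubfield L)) L (IsCMField.complexConj L) N (Matrix.diagonal dV)
          (archSingle (↥(maximalRealSubfield L)) L (IsCMField.complexConj L) N (Matrix.diagonal dV)
            (IsCMField.complexConj_ne_one L) (complexConj_smul_infinitePlace L) w₀ u), 1) Φ = Φ := by
  rw [cmPairRepTwist_archSingle_one_eq_zpow_smul L e dV hdV hdV0 dW hdW hdW0 hGR χV χW w₀ hnV hΦ u, hn,
    add_neg_cancel, zpow_zero, one_smul]

end OnePlace

/-! ## §3. The normalising character exists for every prescription of archimedean exponents -/

section Exists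

variable (L : Type) [Field L] [NumberField L] [IsCMField L]

/-- For raw exponents `a` and targets `t` there is a continuous unitary character of `[U(1)]` of archimedean type
`t − a` (the tree's `exists_unitaryLineChar_hasArchType`). [cite: GelbartRogawski1991, §3.1 Remark p. 457 L4–13] -/
theorem exists_hasArchType_sub (a t : InfinitePlace L → ℤ) :
    ∃ χ : ContinuousMonoidHom
        (relNormOneIdeles (↥(maximalRealSubfield L)) L ⧸ relNormOneRat (↥(maximalRealSubfield L)) L) Circle,
      UnitaryLineChar.HasArchType L χ (t - a) :=
  exists_unitaryLineChar_hasArchType L (t - a)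

variable {N M n : ℕ} (e : Fin N × Fin M ≃ Fin n)
variable (dV : Fin N → L) (hdV : ∀ i, IsCMField.complexConj L (dV i) = dV i) (hdV0 : ∀ i, dV i ≠ 0)
variable (dW : Fin M → L) (hdW : ∀ i, IsCMField.complexConj L (dW i) = dW i) (hdW0 : ∀ i, dW i ≠ 0)
variable (hGR : (cmSplittingDatum L e dV hdV hdV0 dW hdW hdW0).CompatibleSplitting)
variable (χW : ContinuousMonoidHom
  (relNormOneIdeles (↥(maximalRealSubfield L)) L ⧸ relNormOneRat (↥(maximalRealSubfield L)) L) Circle)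

/-- **Normalisation to prescribed exponents, all places at once.**  If at every place `w₀` the group
`U(σ_{w₀} V)(ℂ)` acts on `Φ` through the raw splitting by `(det u)^{a w₀}`, then for every target `t` there is a
`χ_V` (of type `t − a`) such that through `s_pair ⊗ ((χ_V ∘ det_V) ⊠ (χ_W ∘ det_W))` it acts by `(det u)^{t w₀}` at every
place — in particular trivially wherever `t w₀ = 0`. [cite: GelbartRogawski1991, §3.1 Remark p. 457 L4–13] -/
theorem exists_twist_forall_archSingle_eq_zpow_smul {Φ : CMSchwartz L n} (a t : InfinitePlace L → ℤ)
    (hΦ : ∀ (w₀ : {w : InfinitePlace L // IsComplex w}) (u : archLocal L N (Matrix.diagonal dV) w₀),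
      cmPairRep L e dV hdV hdV0 dW hdW hdW0 hGR
          (archToAdelic (↥(maximalRealSubfield L)) L (IsCMField.complexConj L) N (Matrix.diagonal dV)
            (archSingle (↥(maximalRealSubfield L)) L (IsCMField.complexConj L) N (Matrix.diagonal dV)
              (IsCMField.complexConj_ne_one L) (complexConj_smul_infinitePlace L) w₀ u), 1) Φ =
        (((u : archLocal L N (Matrix.diagonal dV) w₀) : GL (Fin N) ℂ) : Matrix (Fin N) (Fin N) ℂ).det ^ (a w₀.1) • Φ) :
    ∃ χV : ContinuousMonoidHom
        (relNormOneIdeles (↥(maximalRealSubfield L)) L ⧸ relNormOneRat (↥(maximalRealSubfield L)) L) Circle,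
      UnitaryLineChar.HasArchType L χV (t - a) ∧
        ∀ (w₀ : {w : InfinitePlace L // IsComplex w}) (u : archLocal L N (Matrix.diagonal dV) w₀),
          cmPairRepTwist L e dV hdV hdV0 dW hdW hdW0 hGR
              (cmDetTwistChar L dV hdV0 dW hdW0 (charOfUnitaryLineChar L χV) (charOfUnitaryLineChar L χW))
              (archToAdelic (↥(maximalRealSubfield L)) L (IsCMField.complexConj L) N (Matrix.diagonal dV)
                (archSingle (↥(maximalRealSubfield L)) L (IsCMField.complexConj L) N (Matrix.diagonal dV)
                  (IsCMField.complexConj_ne_one L) (complexConj_smul_infinitePlace L) w₀ u), 1) Φ =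
            (((u : archLocal L N (Matrix.diagonal dV) w₀) : GL (Fin N) ℂ) : Matrix (Fin N) (Fin N) ℂ).det ^ (t w₀.1) • Φ := by
  obtain ⟨χV, hχ⟩ := exists_hasArchType_sub L a t
  refine ⟨χV, hχ, fun w₀ u => ?_⟩
  rw [cmPairRepTwist_archSingle_one_eq_zpow_smul L e dV hdV hdV0 dW hdW hdW0 hGR χV χW w₀ hχ (hΦ w₀) u,
    Pi.sub_apply, add_sub_cancel]

end Exists

end Literature.NumberTheory.GelbartRogawski1991.UnitaryDualPair
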